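import Summits.ResolutionOfSingularities.ResolutionOfSingularities.Theorems.ForcedTowerClasses
import Summits.ResolutionOfSingularities.ResolutionOfSingularities.Theorems.WeakOrderReduction
import Summits.ResolutionOfSingularities.ResolutionOfSingularities.Theorems.FrobeniusBracketPow
import HarnessLib

/-!
# PurityValveClasses — Fedder purity of core points as a one-way valve of the weak order-reduction game
(decomp-res node N49 «PurityValve», lens-6 g9; route-independent part, phase 1)

Source HOME/decomp-res-lens-6/g9/PurityValve.lean (sha256 dd3d1f175e2a2a66, 495 lines; critic `lean check` rc 0,
0 sorry), CRITIC-LEDGER row 59 (2026-08-30T08:43Z): CLEARED (MAP +1 exact dynamical split, VALVE LEMMA +1,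
pieces 0).  Parent BY NAME: `MaxContactCut.RungOne` (29273; marking-`n` slice `ForcedTowerClasses.WOR n`) and the
PURE-LOW₄ slice 30702 of the located core.  A CORE point of a marking-`n` datum: `ord_y 𝓘 = n` and lens-2 class 1;
PURE: `𝓘_y^(p-1) ⊄ 𝔪_y^[p]` (Fedder; `FrobeniusBracketPow.FedderImpureAt`).
* (EM, exact, PROVED) `WOR n ⟺ WORPure n ∧ WORImpure n` and `WOR n ⟺ Purification n ∧ WORPure n` (⇐ by composing
  centre sequences, `seqAppend`, PROVED; ⇒ modulo the costume `BaseStable`): FIRST purify, THEN win the pure game;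
* (THE VALVE, PROVED from the costume ports `CartierLift` + `NearPointLift n`) `3 ≤ n → PureForwardClosed n`: a
  weakly admissible blow-up of a datum whose core points are all pure again has only pure core points (the
  Cartier–Frobenius trace lifts a Fedder witness along a centre of codimension `c ≤ n + 1` — automatic for
  `n ≥ 3` in dimension `≤ 4`, FALSE at `n = 2` for point centres); so the pure game `WORPure 3` is a CLOSED
  SUB-GAME (`pure_along_sequence`) and `Purification 3` a ONE-SHOT obligation (`purification_stable`);
* (CERTIFICATES, PROVED) `zariski_bound` / `centre_bound`: every Zariski / Cossart–Piltant purely-inseparable core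
  point at `(p, n, dim) = (3, 3, 4)` is IMPURE, and no pure point lies on an equimultiple centre of codimension
  `< n`; (HIGH ORDERS, PROVED mod the definitional port `TauOneHyperplanar`) for `2 ≤ p ≤ n`, `n ≥ 4 ≥ dim Y`
  core points are impure: the valve has teeth exactly at `(n, dim) = (3, 4)`.
Tags: `WORPure n` WEAKER · UNDECIDED · IDEA-NEEDED + INSTRUMENTABLE (T-pure-game); `WORImpure n` / `Purification n`
residual-grade (0); `PureForwardClosed n`, `n ≥ 3` DECIDED-MOD-PORT; ports COSTUME.  The `∀ n ≥ 1` shapes are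
asides of `Theses/MaxContactCut.lean` refining 29273; by-name kernels: `Theorems/MaxContactCutPurityValve.lean`.
(Sources: Fedder1983 Thm 1.12; LakshmibaiMehtaParameswaran1998 §2; LauritzenThomsen2011 arXiv:1004.2847 Prop. 2.4,
Lemma 2.12; CossartJannsenSaito2020 Thm 2.10; Kollar2007 3.74–3.76; CossartPiltant2019;
BierstoneGrigorievMilmanWlodarczyk2011 §3.2.)
-/

open CategoryTheory AlgebraicGeometry
open Literature.AlgebraicGeometry.Resolution
open Summit.ResolutionOfSingularities.ResolutionOfSingularities.Theorems.WeakOrderReduction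
open Summit.ResolutionOfSingularities.ResolutionOfSingularities.Theorems.ForcedTowerClasses
open Summit.ResolutionOfSingularities.ResolutionOfSingularities.Theorems.FrobeniusBracketPow

namespace Summit.ResolutionOfSingularities.ResolutionOfSingularities.Theorems.PurityValveClasses

/-! ## §1 Ring-level certificates (DECIDED, kernel) -/

section Algebra

variable {R : Type*} [CommRing R]

/-- **`zariski_bound`** (DECIDED · kernel).  If `A ≤ (zⁿ) + P^(n+1)` where `P ≤ J` is generated by `≤ n` elements,
`z ∈ J` and `2 ≤ p ≤ n`, then `A^(p-1) ≤ J^[p]`.  At `(p, n) = (3, 3)` in a 4-dimensional regular local ring with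
`J = 𝔪 = (z) + P`, `P = (x, y, w)`: every germ `u·z³ + c` with `c ∈ (x, y, w)⁴` — in particular every purely
inseparable Weierstrass equation `z³ + c(x, y, w)` of order 3 with cube initial form — is Fedder-IMPURE.  So the
F-pure order-3 class-1 points are disjoint from the Zariski / Cossart–Piltant purely-inseparable class. [folklore] -/
theorem zariski_bound [DecidableEq R] {J P : Ideal R} (hPJ : P ≤ J) (S : Finset R)
    (hS : Ideal.span (S : Set R) = P) {z : R} (hz : z ∈ J) {p n : ℕ} (hp : 2 ≤ p) (hpn : p ≤ n)
    (hSn : S.card ≤ n) {A : Ideal R} (hA : A ≤ Ideal.span {z ^ n} ⊔ P ^ (n + 1)) :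
    A ^ (p - 1) ≤ bracketPow J p := by
  obtain ⟨m, hm⟩ : ∃ m, p - 1 = m + 1 := ⟨p - 2, by omega⟩
  have h1 : A ^ (p - 1) ≤ Ideal.span {z ^ n} ⊔ (P ^ (n + 1)) ^ (p - 1) := by
    rw [hm]
    exact (Ideal.pow_right_mono hA _).trans (sup_pow_le_sup_pow _ _ m)
  refine h1.trans (sup_le ?_ ?_)
  · rw [Ideal.span_le, Set.singleton_subset_iff]
    have : z ^ n = z ^ p * z ^ (n - p) := by rw [← pow_add, Nat.add_sub_cancel' hpn]
    rw [this]
    exact Ideal.mul_mem_right _ _ (pow_mem_bracketPow hz)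
  · rw [← pow_mul]
    refine (Ideal.pow_le_pow_right ?_).trans
      ((pow_le_bracketPow_of_span S hS p (by omega)).trans (bracketPow_mono hPJ p))
    have : S.card * (p - 1) ≤ n * (p - 1) := Nat.mul_le_mul_right _ hSn
    rw [hm] at this ⊢
    nlinarith

/-- **`centre_bound`** (DECIDED · kernel).  If `A ≤ Pⁿ` where `P` is generated by `c` elements with `c + 1 ≤ n` and
`2 ≤ p`, then `A^(p-1) ≤ P^[p]` (pigeonhole: `n(p-1) ≥ c(p-1) + 1`).  Since `P^[p] ≤ 𝔪^[p]`, no Fedder-pure point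
lies on an equimultiple (order-`n`) regular centre of codimension `< n`: in the pure game at `n = 3` in dimension 4
every weakly admissible centre is a point or a curve. [folklore] -/
theorem centre_bound [DecidableEq R] {P : Ideal R} (S : Finset R) (hS : Ideal.span (S : Set R) = P) {p n : ℕ}
    (hp : 2 ≤ p) (hSn : S.card + 1 ≤ n) {A : Ideal R} (hA : A ≤ P ^ n) : A ^ (p - 1) ≤ bracketPow P p := by
  obtain ⟨m, hm⟩ : ∃ m, p - 1 = m + 1 := ⟨p - 2, by omega⟩
  refine (Ideal.pow_right_mono hA _).trans ?_
  rw [← pow_mul]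
  refine (Ideal.pow_le_pow_right ?_).trans (pow_le_bracketPow_of_span S hS p (by omega))
  have : (S.card + 1) * (p - 1) ≤ n * (p - 1) := Nat.mul_le_mul_right _ hSn
  rw [hm] at this ⊢
  nlinarith

end Algebra

/-! ## §2 Composition of centre sequences (DECIDED, kernel; the tree's `CentreSeq` has no `append`) -/

/-- Concatenation of a centre sequence on `X` with a centre sequence on its top. [folklore] -/
noncomputable def seqAppend : {X : Scheme.{0}} → (s : CentreSeq X) → CentreSeq s.top → CentreSeq X
  | _, .nil _, t => t
  | _, .cons C rest, t => .cons C (seqAppend rest t)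

/-- Weak admissibility of a concatenation. [folklore] -/
theorem weakAdmissible_seqAppend : ∀ {X : Scheme.{0}} (s : CentreSeq X) (t : CentreSeq s.top) (M : MarkedIdeal X),
    WeakAdmissible (seqAppend s t) M ↔ WeakAdmissible s M ∧ WeakAdmissible t (s.transformMarked M)
  | _, .nil _, t, M => by
      show WeakAdmissible t M ↔ True ∧ WeakAdmissible t M
      simp
  | _, .cons C rest, t, M => by
      show (_ ∧ _ ∧ WeakAdmissible (seqAppend rest t) _) ↔ (_ ∧ _ ∧ _) ∧ _
      rw [weakAdmissible_seqAppend rest t]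
      constructor
      · rintro ⟨h1, h2, h3, h4⟩; exact ⟨⟨h1, h2, h3⟩, h4⟩
      · rintro ⟨⟨h1, h2, h3⟩, h4⟩; exact ⟨h1, h2, h3, h4⟩

/-- The final support of a concatenation is empty iff the final support of the second leg is. [folklore] -/
theorem support_seqAppend_eq_empty : ∀ {X : Scheme.{0}} (s : CentreSeq X) (t : CentreSeq s.top) (M : MarkedIdeal X),
    ((seqAppend s t).transformMarked M).support = ∅ ↔ (t.transformMarked (s.transformMarked M)).support = ∅
  | _, .nil _, _, _ => Iff.rfl
  | _, .cons _ rest, t, _ => support_seqAppend_eq_empty rest t _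

/-- **Weak resolutions compose**: `s` weakly admissible for `M` and `t` a weak resolution of the transform give the
weak resolution `s ++ t` of `M`. [folklore] -/
theorem weakResolution_seqAppend {X : Scheme.{0}} (s : CentreSeq X) (t : CentreSeq s.top) (M : MarkedIdeal X)
    (hs : WeakAdmissible s M) (ht : WeakResolution t (s.transformMarked M)) : WeakResolution (seqAppend s t) M :=
  ⟨(weakAdmissible_seqAppend s t M).2 ⟨hs, ht.1⟩, (support_seqAppend_eq_empty s t M).2 ht.2⟩

/-! ## §3 Core points, purity, and the exact cuts of `WOR n` -/

/-- CORE point of `(𝓘, n)` at `y`: `ord_y 𝓘 = n` and class 1 — neither contact nor `τ ≥ 2` (`¬ ClassGE … 2`).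
DEFINITION (support). -/
def IsCorePt {k : Type} [Field k] {Y : Scheme.{0}} (g : Y ⟶ Spec (.of k)) (hY : Scheme.IsRegular Y)
    (I : Y.IdealSheafData) (n : ℕ) (y : Y) : Prop :=
  idealOrder I y = ((n : ℕ) : ℕ∞) ∧ ¬ ClassGE g hY I n 2 y

/-- ALL CORE POINTS PURE: every core point of `(𝓘, n)` is Fedder-pure (`𝓘_y^(p-1) ⊄ 𝔪_y^[p]`).
DEFINITION (support). -/
def AllCorePure (p : ℕ) {k : Type} [Field k] {Y : Scheme.{0}} (g : Y ⟶ Spec (.of k)) (hY : Scheme.IsRegular Y)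
    (I : Y.IdealSheafData) (n : ℕ) : Prop :=
  ∀ y : Y, IsCorePt g hY I n y → ¬ FedderImpureAt I p y

/-- **piece · `WORPure n`** — weak order reduction at marking `n` (dim ≤ 4, any boundary) for data ALL of whose core
points are Fedder-pure.  UNDECIDED (test: T-pure-game below) · WEAKER than `WOR n` (kernel `worPure_of_wor`; it
drops every catalogued wild specimen at `(p,n)=(3,3)`, all impure by `zariski_bound`) · leaf IDEA-NEEDED +
INSTRUMENTABLE at `n = 3` (closed sub-game by `pureForwardClosed_of_lifts`; no engine: the pure core point
`z³ + yxw·z + yx²w + …` reproduces at the exceptional vertex under point blow-ups); for `p ≤ n`, `n ≥ 4` it is the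
class-≥2 statement (`fedderImpure_of_core_high`). [folklore] -/
def WORPure (n : ℕ) : Prop :=
  ∀ p : ℕ, p.Prime → ∀ (k : Type) [Field k] [CharP k p] (Y : Scheme.{0}) (g : Y ⟶ Spec (.of k))
    (hB : IsBase Y g), ∀ M : MarkedIdeal Y, IsDatum n M → AllCorePure p g hB.isRegular M.ideal n →
      ∃ t : CentreSeq Y, WeakResolution t M

/-- **piece · `WORImpure n`** — weak order reduction at marking `n` for data with SOME Fedder-impure core point.
UNDECIDED · WEAKER than `WOR n` by kernel (`worImpure_of_wor`; drops the open F-pure class) but RESIDUAL-GRADE: it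
contains every Zariski / Cossart–Piltant purely-inseparable core point (`zariski_bound`) · leaf BARRIER
(`DimensionFourFrontier`); equivalent to `Purification n` given `WORPure n` (kernels below). [folklore] -/
def WORImpure (n : ℕ) : Prop :=
  ∀ p : ℕ, p.Prime → ∀ (k : Type) [Field k] [CharP k p] (Y : Scheme.{0}) (g : Y ⟶ Spec (.of k))
    (hB : IsBase Y g), ∀ M : MarkedIdeal Y, IsDatum n M →
      (∃ y : Y, IsCorePt g hB.isRegular M.ideal n y ∧ FedderImpureAt M.ideal p y) →
      ∃ t : CentreSeq Y, WeakResolution t M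

/-- **piece · `Purification n`** — every datum with an impure core point admits a weakly admissible sequence after
which the transform is again an order-`≤ n` datum on a regular base ALL of whose core points are pure (support need
not be empty).  UNDECIDED · RESIDUAL-GRADE (a permanently impure purely-inseparable core point can only be purified
by removing it from the top locus) · WEAKER than `WORImpure n` (kernel `purification_of_worImpure` mod
`BaseStable`) · at `n = 3` a ONE-SHOT obligation (the valve never lets impurity return). [folklore] -/
def Purification (n : ℕ) : Prop :=
  ∀ p : ℕ, p.Prime → ∀ (k : Type) [Field k] [CharP k p] (Y : Scheme.{0}) (g : Y ⟶ Spec (.of k))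
    (hB : IsBase Y g), ∀ M : MarkedIdeal Y, IsDatum n M →
      (∃ y : Y, IsCorePt g hB.isRegular M.ideal n y ∧ FedderImpureAt M.ideal p y) →
      ∃ t : CentreSeq Y, WeakAdmissible t M ∧ ∃ hB' : IsBase t.top (t.comp ≫ g),
        IsDatum n (t.transformMarked M) ∧ AllCorePure p (t.comp ≫ g) hB'.isRegular (t.transformMarked M).ideal n

/-- **port · `BaseStable`** — the blow-up of a regular separated finite-type quasi-compact `Y/k` of dimension `≤ 4`
in a regular centre is again such.  COSTUME (GortzWedhorn2020 Prop. 13.91/13.96; EGA IV₄ 19.4.3–19.4.4). -/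
def BaseStable : Prop :=
  ∀ (k : Type) [Field k] (Y : Scheme.{0}) (g : Y ⟶ Spec (.of k)), IsBase Y g →
    ∀ C : Y.IdealSheafData, Scheme.IsRegular C.subscheme → IsBase (blowup C) (blowup.π C ≫ g)

/-- `WOR n ⟹ WORPure n` (drop the purity hypothesis). [folklore] -/
theorem worPure_of_wor {n : ℕ} (h : WOR n) : WORPure n :=
  fun p hp k _ _ Y g hB M hM _ => h p hp k Y g hB M hM

/-- `WOR n ⟹ WORImpure n`. [folklore] -/
theorem worImpure_of_wor {n : ℕ} (h : WOR n) : WORImpure n :=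
  fun p hp k _ _ Y g hB M hM _ => h p hp k Y g hB M hM

/-- PURE → IMPURE → `WOR n` (excluded middle on «all core points pure», nothing else). [folklore] -/
theorem wor_of_pure_of_impure {n : ℕ} (hQ : WORPure n) (hI : WORImpure n) : WOR n := by
  intro p hp k _ _ Y g hB M hM
  by_cases hall : AllCorePure p g hB.isRegular M.ideal n
  · exact hQ p hp k Y g hB M hM hall
  · have hex : ∃ y : Y, IsCorePt g hB.isRegular M.ideal n y ∧ FedderImpureAt M.ideal p y := by
      by_contra hne
      exact hall fun y hy himp => hne ⟨y, hy, himp⟩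
    exact hI p hp k Y g hB M hM hex

/-- **EXACTNESS**: `WOR n ⟺ WORPure n ∧ WORImpure n`. [folklore] -/
theorem wor_iff_pure_and_impure (n : ℕ) : WOR n ↔ WORPure n ∧ WORImpure n :=
  ⟨fun h => ⟨worPure_of_wor h, worImpure_of_wor h⟩, fun h => wor_of_pure_of_impure h.1 h.2⟩

/-- **PURIFY, THEN PLAY THE PURE GAME**: `Purification n → WORPure n → WORImpure n` (composition of sequences,
kernel `weakResolution_seqAppend`). [folklore] -/
theorem worImpure_of_purification_of_pure {n : ℕ} (hP : Purification n) (hQ : WORPure n) : WORImpure n := by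
  intro p hp k _ _ Y g hB M hM hex
  obtain ⟨t, hadm, hB', hM', hpure⟩ := hP p hp k Y g hB M hM hex
  obtain ⟨t', ht'⟩ := hQ p hp k t.top (t.comp ≫ g) hB' (t.transformMarked M) hM' hpure
  exact ⟨seqAppend t t', weakResolution_seqAppend t t' M hadm ht'⟩

/-- `Purification n → WORPure n → WOR n`. [folklore] -/
theorem wor_of_purification_of_pure {n : ℕ} (hP : Purification n) (hQ : WORPure n) : WOR n :=
  wor_of_pure_of_impure hQ (worImpure_of_purification_of_pure hP hQ)

/-- Along a weakly admissible sequence the base class is kept (mod the costume `BaseStable`). [folklore] -/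
theorem isBase_top (hS : BaseStable) {k : Type} [Field k] :
    ∀ {Y : Scheme.{0}} (t : CentreSeq Y) (g : Y ⟶ Spec (.of k)) (M : MarkedIdeal Y),
      IsBase Y g → WeakAdmissible t M → IsBase t.top (t.comp ≫ g)
  | _, .nil _, g, M, hB, _ => by
      show IsBase _ (𝟙 _ ≫ g)
      simpa using hB
  | _, .cons C rest, g, M, hB, hadm => by
      have hadm' : (C.support : Set _) ⊆ M.support ∧ Scheme.IsRegular C.subscheme ∧
          WeakAdmissible rest (M.transform (blowup.π C) C) := hadm
      have h1 : IsBase (blowup C) (blowup.π C ≫ g) := hS k _ g hB C hadm'.2.1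
      have h2 := isBase_top hS rest (blowup.π C ≫ g) (M.transform (blowup.π C) C) h1 hadm'.2.2
      show IsBase _ ((rest.comp ≫ blowup.π C) ≫ g)
      simpa [Category.assoc] using h2

/-- A weak resolution is in particular a purification: empty final support means no point of order `n` upstairs,
so no core point at all. `WORImpure n → Purification n` (mod `BaseStable`). [folklore] -/
theorem purification_of_worImpure (hS : BaseStable) {n : ℕ} (hI : WORImpure n) : Purification n := by
  intro p hp k _ _ Y g hB M hM hex
  obtain ⟨t, hadm, hsupp⟩ := hI p hp k Y g hB M hM hex
  have hB' : IsBase t.top (t.comp ≫ g) := isBase_top hS t g M hB hadm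
  have hmult : (t.transformMarked M).mult = n := (CentreSeq.transformMarked_mult t M).trans hM.1
  have hlt : ∀ y : t.top, ¬ ((n : ℕ) : ℕ∞) ≤ idealOrder (t.transformMarked M).ideal y := by
    intro y hy
    have hmem : y ∈ (t.transformMarked M).support := by
      rw [MarkedIdeal.mem_support_iff, hmult]
      exact (le_idealOrder_iff _ _ _).1 hy
    rw [hsupp] at hmem
    exact hmem
  refine ⟨t, hadm, hB', ⟨hmult, fun y => le_of_lt (not_le.mp (hlt y))⟩, ?_⟩
  intro y hy _
  exact hlt y (le_of_eq hy.1.symm)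

/-- **EXACTNESS of the dynamical split** (mod `BaseStable`): `WOR n ⟺ Purification n ∧ WORPure n`. [folklore] -/
theorem wor_iff_purification_and_pure (hS : BaseStable) (n : ℕ) : WOR n ↔ Purification n ∧ WORPure n :=
  ⟨fun h => ⟨purification_of_worImpure hS (worImpure_of_wor h), worPure_of_wor h⟩,
    fun h => wor_of_purification_of_pure h.1 h.2⟩

/-! ## §4 THE VALVE: forward invariance of core purity under weakly admissible blow-ups at `n ≥ 3` -/

/-- **piece · `PureForwardClosed n`** — if all core points of the order-`≤ n` datum `M` on a dim-`≤ 4` base are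
pure and `C ⊆ supp M` is a regular centre, then all core points of the transform on `Bl_C Y` are pure.  At `n ≥ 3`:
DECIDED-mod-ports (kernel `pureForwardClosed_of_lifts` from `CartierLift` + `NearPointLift n`).  At `n = 2`: FALSE
for point centres (desk: `f = z² + xyzw + x⁵ + y⁷ + w⁹`, `p = 2`, origin pure core; `x`-chart vertex
`z'² + x²y'z'w' + x³ + …` is an impure core point), TRUE for centres of codimension `≤ 3`. [folklore] -/
def PureForwardClosed (n : ℕ) : Prop :=
  ∀ p : ℕ, p.Prime → ∀ (k : Type) [Field k] [CharP k p] (Y : Scheme.{0}) (g : Y ⟶ Spec (.of k))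
    (hB : IsBase Y g), ∀ M : MarkedIdeal Y, IsDatum n M → AllCorePure p g hB.isRegular M.ideal n →
      ∀ C : Y.IdealSheafData, (C.support : Set Y) ⊆ M.support → Scheme.IsRegular C.subscheme →
        ∀ hY' : Scheme.IsRegular (blowup C),
          AllCorePure p (blowup.π C ≫ g) hY' (M.transform (blowup.π C) C).ideal n

/-- **port · `CartierLift`** — purity descends to EVERY point of a weakly admissible blow-up when the marking is
`≥ 3` (dimension `≤ 4`): `𝓘_{π y'}^(p-1) ⊄ 𝔪^[p] ⟹ (𝓘')_{y'}^(p-1) ⊄ 𝔪'^[p]` for the controlled transform with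
exponent `μ = mult M ≥ 3`.  COSTUME (LakshmibaiMehtaParameswaran1998 §2; LauritzenThomsen2011 Prop. 2.4 + Lemma
2.12: splittings vanishing to order `(c-1)(p-1)` along a smooth centre lift to the blow-up; Fedder1983 Thm 1.12).
Paper proof: a Fedder witness `h·r = t^(n(p-1))·b` with `b ∈ (𝓘')^(p-1)` and `Φ_{R'}(F_*(t^((n-c+1)(p-1)) b)) =
Φ_R(F_*(hr))` a unit since `c ≤ n + 1`.  Caveat: the trace argument uses F-finiteness of `k` (reduce by flat base
change) — ATTACKABLE (port, M-sized local algebra). -/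
def CartierLift : Prop :=
  ∀ p : ℕ, p.Prime → ∀ (k : Type) [Field k] [CharP k p] (Y : Scheme.{0}) (g : Y ⟶ Spec (.of k)),
    IsBase Y g → ∀ M : MarkedIdeal Y, 3 ≤ M.mult → (∀ y : Y, idealOrder M.ideal y ≤ ((M.mult : ℕ) : ℕ∞)) →
      ∀ C : Y.IdealSheafData, (C.support : Set Y) ⊆ M.support → Scheme.IsRegular C.subscheme →
        ∀ y' : ↥(blowup C), ¬ FedderImpureAt M.ideal p ((blowup.π C).base y') →
          ¬ FedderImpureAt (M.transform (blowup.π C) C).ideal p y'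

/-- **port · `NearPointLift n`** — under a weakly admissible blow-up of an order-`≤ n` datum: (0) the transform is
again an order-`≤ n` datum of marking `n`; (1) a point of order `n` upstairs lies over a point of order `n`; (2) if
that point has class ≥ 2 then so has the point upstairs (contact persists by Giraud's lemma; `τ` does not drop at
near points, Hironaka).  COSTUME (CossartJannsenSaito2020 Thm 2.10 (1)(4)(5); Kollar2007 Thm 3.75–3.76;
BierstoneGrigorievMilmanWlodarczyk2011 §3.2).  Caveat: (2) is by letter for principal `𝓘`; in general it is
Hironaka's idealistic-exponent version — ATTACKABLE (port). -/
def NearPointLift (n : ℕ) : Prop :=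
  ∀ p : ℕ, p.Prime → ∀ (k : Type) [Field k] [CharP k p] (Y : Scheme.{0}) (g : Y ⟶ Spec (.of k))
    (hB : IsBase Y g), ∀ M : MarkedIdeal Y, IsDatum n M →
      ∀ C : Y.IdealSheafData, (C.support : Set Y) ⊆ M.support → Scheme.IsRegular C.subscheme →
        ∀ hY' : Scheme.IsRegular (blowup C),
          IsDatum n (M.transform (blowup.π C) C) ∧
          ∀ y' : ↥(blowup C), idealOrder (M.transform (blowup.π C) C).ideal y' = ((n : ℕ) : ℕ∞) →
            idealOrder M.ideal ((blowup.π C).base y') = ((n : ℕ) : ℕ∞) ∧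
            (ClassGE g hB.isRegular M.ideal n 2 ((blowup.π C).base y') →
              ClassGE (blowup.π C ≫ g) hY' (M.transform (blowup.π C) C).ideal n 2 y')

/-- **THE VALVE THEOREM** (kernel from the two costume ports): for markings `n ≥ 3`, core purity is forward-invariant
under every weakly admissible blow-up. [folklore] -/
theorem pureForwardClosed_of_lifts {n : ℕ} (hn : 3 ≤ n) (hL : CartierLift) (hN : NearPointLift n) :
    PureForwardClosed n := by
  intro p hp k _ _ Y g hB M hM hpure C hC hreg hY' y' hcore' himp'
  obtain ⟨-, hnear⟩ := hN p hp k Y g hB M hM C hC hreg hY'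
  obtain ⟨hord, hcls⟩ := hnear y' hcore'.1
  have hcore : IsCorePt g hB.isRegular M.ideal n ((blowup.π C).base y') :=
    ⟨hord, fun h2 => hcore'.2 (hcls h2)⟩
  have hmult : 3 ≤ M.mult := by rw [hM.1]; exact hn
  have hordle : ∀ y : Y, idealOrder M.ideal y ≤ ((M.mult : ℕ) : ℕ∞) := by rw [hM.1]; exact hM.2
  exact hL p hp k Y g hB M hmult hordle C hC hreg y' (hpure _ hcore) himp'

/-- **THE PURE GAME IS A CLOSED SUB-GAME** (kernel): along ANY weakly admissible sequence starting from a datum whose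
core points are all pure, the transform is an order-`≤ n` datum whose core points are all pure (mod the ports, via
`PureForwardClosed n`). [folklore] -/
theorem pure_along_sequence {n : ℕ} (hF : PureForwardClosed n) (hN : NearPointLift n) (hS : BaseStable)
    {p : ℕ} (hp : p.Prime) {k : Type} [Field k] [CharP k p] :
    ∀ {Y : Scheme.{0}} (t : CentreSeq Y) (g : Y ⟶ Spec (.of k)) (M : MarkedIdeal Y) (hB : IsBase Y g),
      IsDatum n M → AllCorePure p g hB.isRegular M.ideal n → WeakAdmissible t M →
        IsDatum n (t.transformMarked M) ∧
          ∀ hB' : IsBase t.top (t.comp ≫ g), AllCorePure p (t.comp ≫ g) hB'.isRegular (t.transformMarked M).ideal n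
  | _, .nil _, g, M, hB, hM, hpure, _ => by
      refine ⟨hM, fun hB' => ?_⟩
      show AllCorePure p (𝟙 _ ≫ g) hB'.isRegular M.ideal n
      simpa using hpure
  | _, .cons C rest, g, M, hB, hM, hpure, hadm => by
      have hadm' : (C.support : Set _) ⊆ M.support ∧ Scheme.IsRegular C.subscheme ∧
          WeakAdmissible rest (M.transform (blowup.π C) C) := hadm
      have hB₁ : IsBase (blowup C) (blowup.π C ≫ g) := hS k _ g hB C hadm'.2.1
      have hM₁ : IsDatum n (M.transform (blowup.π C) C) := (hN p hp k _ g hB M hM C hadm'.1 hadm'.2.1 hB₁.isRegular).1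
      have hpure₁ : AllCorePure p (blowup.π C ≫ g) hB₁.isRegular (M.transform (blowup.π C) C).ideal n :=
        hF p hp k _ g hB M hM hpure C hadm'.1 hadm'.2.1 hB₁.isRegular
      obtain ⟨hM₂, hpure₂⟩ := pure_along_sequence hF hN hS hp rest (blowup.π C ≫ g) _ hB₁ hM₁ hpure₁ hadm'.2.2
      refine ⟨hM₂, fun hB' => ?_⟩
      have hB'' : IsBase rest.top (rest.comp ≫ blowup.π C ≫ g) := by
        have := hB'
        show IsBase _ _
        simpa [CentreSeq.comp, Category.assoc] using this
      have := hpure₂ hB''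
      show AllCorePure p ((rest.comp ≫ blowup.π C) ≫ g) _ _ n
      simpa [Category.assoc] using this

/-- **ONE-SHOT PURIFICATION** (kernel): at a marking where the valve is shut, a purification followed by ANY further
weakly admissible play stays pure — `Purification n` is paid once. [folklore] -/
theorem purification_stable {n : ℕ} (hF : PureForwardClosed n) (hN : NearPointLift n) (hS : BaseStable)
    {p : ℕ} (hp : p.Prime) {k : Type} [Field k] [CharP k p] {Y : Scheme.{0}} (g : Y ⟶ Spec (.of k))
    (M : MarkedIdeal Y) (t : CentreSeq Y) (hB' : IsBase t.top (t.comp ≫ g))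
    (hM' : IsDatum n (t.transformMarked M))
    (hpure : AllCorePure p (t.comp ≫ g) hB'.isRegular (t.transformMarked M).ideal n)
    (u : CentreSeq t.top) (hu : WeakAdmissible u (t.transformMarked M)) (hB'' : IsBase u.top (u.comp ≫ t.comp ≫ g)) :
    AllCorePure p (u.comp ≫ t.comp ≫ g) hB''.isRegular (u.transformMarked (t.transformMarked M)).ideal n :=
  (pure_along_sequence hF hN hS hp u (t.comp ≫ g) (t.transformMarked M) hB' hM' hpure hu).2 hB''

/-! ## §5 Where the valve has teeth: only at `n = 3` (for `p ≤ n`) -/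

/-- **port · `TauOneHyperplanar`** — at a point of order `n` with `τ ≤ 1` the stalk ideal is HYPERPLANAR:
`𝓘_y ⊆ (zⁿ) + 𝔪^(n+1)` for a regular parameter `z`, and `Diff^{≤ i}(𝓘)_y ⊆ (z^(n-i)) + 𝔪^(n-i+1)` (the tree's
hyperplanar clause of 28544).  COSTUME (definition chase: Hironaka's `τ`; CossartPiltant2008). ATTACKABLE. -/
def TauOneHyperplanar : Prop :=
  ∀ (k : Type) [Field k] (Y : Scheme.{0}) (g : Y ⟶ Spec (.of k)) (hY : Scheme.IsRegular Y)
    (I : Y.IdealSheafData) (n : ℕ) (y : Y), 1 ≤ n → idealOrder I y = ((n : ℕ) : ℕ∞) → tauAt hY I n y ≤ 1 →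
      ∃ U : Y.affineOpens, ∃ hy : y ∈ (U : Y.Opens), ∃ z : Y.presheaf.obj (Opposite.op (U : Y.Opens)),
        (Y.presheaf.germ U y hy).hom z ∈ IsLocalRing.maximalIdeal (Y.presheaf.stalk y) ∧
        (Y.presheaf.germ U y hy).hom z ∉ IsLocalRing.maximalIdeal (Y.presheaf.stalk y) ^ 2 ∧
        ∀ i : ℕ, i < n → ∀ u ∈ (diffIdealSheaf (g.appTop.hom.comp (Scheme.ΓSpecIso (.of k)).inv.hom) i I).ideal U,
          (Y.presheaf.germ U y hy).hom u ∈ Ideal.span {(Y.presheaf.germ U y hy).hom z ^ (n - i)} ⊔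
            IsLocalRing.maximalIdeal (Y.presheaf.stalk y) ^ (n - i + 1)

/-- **No pure core points at high order** (kernel mod the definitional port): for `2 ≤ p ≤ n` and `n ≥ 4 ≥ dim Y`
every core point is Fedder-impure (landed certificate `fedderImpure_of_hyperplanar_of_regular`).  Hence for such
`(p, n)` the pure class is the class-≥2 class (`SeqDimFour 2 n`, i.e. inside `E 2`), and the F-valve bites only at
`n = 3`. [folklore] -/
theorem fedderImpure_of_core_high (hT : TauOneHyperplanar) {p : ℕ} {k : Type} [Field k] {Y : Scheme.{0}}
    (g : Y ⟶ Spec (.of k)) (hB : IsBase Y g) (I : Y.IdealSheafData) {n : ℕ} (hp : 2 ≤ p) (hpn : p ≤ n)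
    (hn : 4 ≤ n) {y : Y} (hy : IsCorePt g hB.isRegular I n y) : FedderImpureAt I p y := by
  have hτ : tauAt hB.isRegular I n y ≤ 1 := by
    by_contra hτ
    exact hy.2 (Or.inr (Or.inr ⟨by norm_num, by omega⟩))
  have hhyp := hT k Y g hB.isRegular I n y (by omega) hy.1 hτ
  exact (fedderImpureAt_iff I p y).2
    (fedderImpure_of_hyperplanar_of_regular g hB.isRegular (d := 4) hB.dim_le I hp hpn hn hhyp)

/-- For `2 ≤ p ≤ n`, `n ≥ 4`: a datum has all core points pure iff it has NO core points (all order-`n` points have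
class ≥ 2). [folklore] -/
theorem allCorePure_iff_no_core_high (hT : TauOneHyperplanar) {p : ℕ} {k : Type} [Field k] {Y : Scheme.{0}}
    (g : Y ⟶ Spec (.of k)) (hB : IsBase Y g) (I : Y.IdealSheafData) {n : ℕ} (hp : 2 ≤ p) (hpn : p ≤ n)
    (hn : 4 ≤ n) : AllCorePure p g hB.isRegular I n ↔ ∀ y : Y, ¬ IsCorePt g hB.isRegular I n y :=
  ⟨fun h y hy => h y hy (fedderImpure_of_core_high hT g hB I hp hpn hn hy), fun h y hy => (h y hy).elim⟩

/-! ## §6 Up to `E 1` (route-independent; by-name kernels in `MaxContactCutPurityValve`) -/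

/-- `(∀ n ≥ 1, Purification n) → (∀ n ≥ 1, WORPure n) → E 1`. [folklore] -/
theorem e_one_of_pieces (hP : ∀ n, 1 ≤ n → Purification n) (hQ : ∀ n, 1 ≤ n → WORPure n) : E 1 :=
  fun n hn => seqDimFour_one_of_wor (wor_of_purification_of_pure (hP n hn) (hQ n hn))

/-- Necessity: the sequence-form pieces are `WOR n`-implied (none exceeds its parent; `Purification` modulo the
costume `BaseStable`). [folklore] -/
theorem pieces_of_wor (hS : BaseStable) {n : ℕ} (h : WOR n) : WORPure n ∧ WORImpure n ∧ Purification n :=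
  ⟨worPure_of_wor h, worImpure_of_wor h, purification_of_worImpure hS (worImpure_of_wor h)⟩

/-- … hence `E 1`-implied for every marking. [folklore] -/
theorem pieces_of_e_one (hS : BaseStable) (h : E 1) :
    (∀ n, 1 ≤ n → WORPure n) ∧ (∀ n, 1 ≤ n → Purification n) :=
  ⟨fun n hn => worPure_of_wor (wor_of_seqDimFour_one (h n hn)),
    fun n hn => (pieces_of_wor hS (wor_of_seqDimFour_one (h n hn))).2.2⟩

end Summit.ResolutionOfSingularities.ResolutionOfSingularities.Theorems.PurityValveClasses
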